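import Mathlib
import Summits.Ventures.HodgeRepro.Tier4.Line4.LevelSplit
import Summits.Ventures.HodgeRepro.Tier4.Line4.TorusFinSplit
import Summits.Ventures.HodgeRepro.Tier4.Line4.RatioReduce

/-!
# Tier4/Line4/SuppMeasureSplit — the support measure factors along the `S`-split: `suppMeasure = c c′ · vol_S · vol^{(S)}`,
and along `p^n` the away factor is `n`-free (C-L4-PSPLIT, Part B.4)

Blind re-derivation cell `pub-hodge-repro`, Tier 4 «prove the step» (README §9–§10), seat t4-L2-p1 (gen 3; plan-4 g5's cut
C-L4-PSPLIT S15510 (4), statement S15526).  Tree path `lean/Summits/Ventures/HodgeRepro/Tier4/Line4/SuppMeasureSplit.lean`.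
Imports `Line4/LevelSplit` (`mem_levelDoubleCoset_iff_parts`, `mem_levelDoubleCoset_pow_iff_of_mem_trivialOn`),
`Line4/TorusFinSplit` (the splits), `Line4/RatioReduce` (`suppMeasure_eq_lintegral_fibre`, `fibreSet`).  Four definitions
(`suppSetAt`, `suppSetAway`, `suppMeasureAt`, `suppMeasureAway`); no literature.

THE SET LEVEL.  `suppSetAt` / `suppSetAway` are the `S`-factor and the away factor of the support set;
**`mem_suppSet_iff_parts`**: `(b, b′) ∈ suppSet γ₀ N γ ↔ (b_S, b′_S) ∈ suppSetAt ∧ (b^{(S)}, b′^{(S)}) ∈ suppSetAway` along the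
splits; **`suppSetAway_pow_eq`**: the away factor is `n`-free along `p^n`.
THE PRODUCT DOMAIN.  The `Z_f`-domain enters as `DZ_f := torusFinSplit⁻¹(DZ_S ×ˢ DZ^{(S)})` (a product along the split —
plan-4 S15510 (3): `DZ_S × DZ^{(S)}` is a product fundamental domain for the rational centre, to be matched against
ZDOMAIN-EX by its owner), and the Haar measures as `ν_f = c • (ν_S ⊗ ν^{(S)})`, `ν′_f = c′ • (ν′_S ⊗ ν′^{(S)})` transported along
the splits (TorusFinSplitHaar, `exists_smul_map_prod_eq_fin`).
THE FACTORISATION.  `suppMeasure_eq_lintegral_fibre` writes `suppMeasure = ∫⁻_{b ∈ DZ_f} ν′_f(fibreSet b)`; each fibre is the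
product `fibreAt(b_S) × fibreAway(b^{(S)})` along `torusFinSplit'` (`preimage_symm_fibreSet`, from `mem_suppSet_iff_parts`),
so `ν′_f(fibreSet b) = c′ ν′_S(fibreAt b_S) ν′^{(S)}(fibreAway b^{(S)})` (`measure_fibreSet_eq`); the outer integral of the
product function over the product domain splits by Fubini (`lintegral_prod_mul`), giving
**`suppMeasure_eq_mul`**: `suppMeasure γ₀ DZ_f N γ = (c c′) · suppMeasureAt S ν_S ν′_S γ₀ DZ_S N γ · suppMeasureAway S … γ`
with `suppMeasureAt := (ν_S ⊗ ν′_S)(suppSetAt ∩ DZ_S × T′_S)` and `suppMeasureAway := (ν^{(S)} ⊗ ν′^{(S)})(suppSetAway ∩ DZ^{(S)} ×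
T′^{(S)})` (`suppMeasureAt_eq_lintegral`, `suppMeasureAway_eq_lintegral`: their fibre forms).
**`suppMeasureAway_pow_eq`**: along `p^n` with `S = placesAbove p` the away factor is its level-one value — so
`suppMeasure (p^n) γ = (c c′) · vol_S(n) · vol^{(S)}(1)` (S15510 (4)), in particular at `γ = γ₀` (the unit).

Nothing here says anything about the status of the Hodge conjecture for CM abelian varieties, which is NOT proved
(HC_CM is NOT proved by anyone in this repository).
-/

set_option autoImplicit false
noncomputable section
namespace Summit.Ventures.HodgeRepro.Tier4.Line4
open Summit.Ventures.HodgeRepro.Tier4 Summit.Ventures.HodgeRepro.Tier4.Common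
  Summit.Ventures.HodgeRepro.Tier4.Line1 NumberField IsDedekindDomain MeasureTheory
open scoped NumberField Classical NNReal ENNReal

section SuppSet
variable {k : Type} [Field k] [NumberField k] (W : PlaneData k) (S : Set (HeightOneSpectrum (𝓞 k))) (γ₀ : GA W) (N : ℕ)
  (γ : GA W)

/-- **The `S`-factor of the support set**: the pairs `(x, x′) ∈ T_S × T′_S` with `x⁻¹ (γ_f)_S x′ ∈ K(N) (γ₀,f)_S K(N)`. -/
def suppSetAt : Set (torusFinAt W S × torusFinAt' W S) :=
  {p | ((((p.1 : torusFin W) : torusT W) : GA W))⁻¹ * GA.ofPlacesPart W S (GA.ofFinPart W γ) *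
    (((p.2 : torusFin' W) : torusT' W) : GA W) ∈ levelDoubleCoset W N (GA.ofPlacesPart W S (GA.ofFinPart W γ₀))}

/-- **The away factor of the support set**: the pairs `(y, y′) ∈ T_f^{(S)} × T′_f^{(S)}` with
`y⁻¹ (γ_f)^{(S)} y′ ∈ K(N) (γ₀,f)^{(S)} K(N)`. -/
def suppSetAway : Set (torusFinAway W S × torusFinAway' W S) :=
  {p | ((((p.1 : torusFin W) : torusT W) : GA W))⁻¹ * GA.offPlacesPart W S (GA.ofFinPart W γ) *
    (((p.2 : torusFin' W) : torusT' W) : GA W) ∈ levelDoubleCoset W N (GA.offPlacesPart W S (GA.ofFinPart W γ₀))}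

/-- **THE SUPPORT SET FACTORS ALONG THE `S`-SPLITS**: `(b, b′) ∈ suppSet γ₀ N γ ↔ (b_S, b′_S) ∈ suppSetAt ∧
(b^{(S)}, b′^{(S)}) ∈ suppSetAway`. -/
theorem mem_suppSet_iff_parts (b : torusFin W) (b' : torusFin' W) :
    (b, b') ∈ suppSet W γ₀ N γ ↔
      (atTf W S b, atTf' W S b') ∈ suppSetAt W S γ₀ N γ ∧ (awayTf W S b, awayTf' W S b') ∈ suppSetAway W S γ₀ N γ := by
  have hb : ((b : torusT W) : GA W) ∈ finitePart W := b.2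
  have hb' : ((b' : torusT' W) : GA W) ∈ finitePart W := b'.2
  have hfin : (((b : torusT W) : GA W))⁻¹ * GA.ofFinPart W γ * ((b' : torusT' W) : GA W) ∈ finitePart W :=
    mul_mem (mul_mem (inv_mem hb) (ofFinPart_mem_finitePart' W γ)) hb'
  have h := mem_levelDoubleCoset_iff_parts W S hfin (ofFinPart_mem_finitePart' W γ₀) N
  show _ ↔ _ ∧ _
  rw [suppSetAt, suppSetAway, Set.mem_setOf_eq, Set.mem_setOf_eq, coe_atTf, coe_atTf', coe_awayTf, coe_awayTf',
    ← ofPlacesPart_inv, ← offPlacesPart_inv, ← ofPlacesPart_mul, ← ofPlacesPart_mul, ← offPlacesPart_mul,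
    ← offPlacesPart_mul]
  exact h

/-- **THE AWAY FACTOR IS `n`-FREE ALONG `p^n`**: `suppSetAway (placesAbove p) γ₀ (p^n) γ = suppSetAway (placesAbove p) γ₀ 1 γ`. -/
theorem suppSetAway_pow_eq (p n : ℕ) :
    suppSetAway W (placesAbove (k := k) p) γ₀ (p ^ n) γ = suppSetAway W (placesAbove (k := k) p) γ₀ 1 γ := by
  ext ⟨y, y'⟩
  simp only [suppSetAway, Set.mem_setOf_eq]
  have hy : (((y : torusFin W) : torusT W) : GA W) ∈ trivialOn W (placesAbove (k := k) p) := y.2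
  have hy' : (((y' : torusFin' W) : torusT' W) : GA W) ∈ trivialOn W (placesAbove (k := k) p) := y'.2
  have hyf : (((y : torusFin W) : torusT W) : GA W) ∈ finitePart W := (y : torusFin W).2
  have hyf' : (((y' : torusFin' W) : torusT' W) : GA W) ∈ finitePart W := (y' : torusFin' W).2
  exact mem_levelDoubleCoset_pow_iff_of_mem_trivialOn W
    (mul_mem (mul_mem (inv_mem hyf) (offPlacesPart_mem_finitePart W _ _)) hyf')
    (offPlacesPart_mem_finitePart W _ _)
    (mul_mem (mul_mem (inv_mem hy) (offPlacesPart_mem_trivialOn W _ _)) hy')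
    (offPlacesPart_mem_trivialOn W _ _) n

end SuppSet

section Fibres
variable {k : Type} [Field k] [NumberField k] (W : PlaneData k) (S : Set (HeightOneSpectrum (𝓞 k))) (γ₀ : GA W) (N : ℕ)
  (γ : GA W)

/-- The `S`-fibre of the support set at `x ∈ T_S`. -/
def fibreAt (x : torusFinAt W S) : Set (torusFinAt' W S) := Prod.mk x ⁻¹' suppSetAt W S γ₀ N γ

/-- The away fibre of the support set at `y ∈ T_f^{(S)}`. -/
def fibreAway (y : torusFinAway W S) : Set (torusFinAway' W S) := Prod.mk y ⁻¹' suppSetAway W S γ₀ N γ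

/-- `suppSetAt` is closed (`N ≠ 0`). -/
theorem isClosed_suppSetAt (hN : N ≠ 0) : IsClosed (suppSetAt W S γ₀ N γ) := by
  haveI : T2Space (GA W) := t2Space_GA W
  have hcont : Continuous fun p : torusFinAt W S × torusFinAt' W S =>
      ((((p.1 : torusFin W) : torusT W) : GA W))⁻¹ * GA.ofPlacesPart W S (GA.ofFinPart W γ) *
        (((p.2 : torusFin' W) : torusT' W) : GA W) := by
    have h1 : Continuous fun p : torusFinAt W S × torusFinAt' W S => (((p.1 : torusFin W) : torusT W) : GA W) :=
      continuous_subtype_val.comp (continuous_subtype_val.comp (continuous_subtype_val.comp continuous_fst))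
    have h2 : Continuous fun p : torusFinAt W S × torusFinAt' W S => (((p.2 : torusFin' W) : torusT' W) : GA W) :=
      continuous_subtype_val.comp (continuous_subtype_val.comp (continuous_subtype_val.comp continuous_snd))
    exact ((continuous_inv.comp h1).mul continuous_const).mul h2
  exact (isCompact_levelDoubleCoset W hN _).isClosed.preimage hcont

/-- `suppSetAway` is closed (`N ≠ 0`). -/
theorem isClosed_suppSetAway (hN : N ≠ 0) : IsClosed (suppSetAway W S γ₀ N γ) := by
  haveI : T2Space (GA W) := t2Space_GA W
  have hcont : Continuous fun p : torusFinAway W S × torusFinAway' W S =>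
      ((((p.1 : torusFin W) : torusT W) : GA W))⁻¹ * GA.offPlacesPart W S (GA.ofFinPart W γ) *
        (((p.2 : torusFin' W) : torusT' W) : GA W) := by
    have h1 : Continuous fun p : torusFinAway W S × torusFinAway' W S => (((p.1 : torusFin W) : torusT W) : GA W) :=
      continuous_subtype_val.comp (continuous_subtype_val.comp (continuous_subtype_val.comp continuous_fst))
    have h2 : Continuous fun p : torusFinAway W S × torusFinAway' W S => (((p.2 : torusFin' W) : torusT' W) : GA W) :=
      continuous_subtype_val.comp (continuous_subtype_val.comp (continuous_subtype_val.comp continuous_snd))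
    exact ((continuous_inv.comp h1).mul continuous_const).mul h2
  exact (isCompact_levelDoubleCoset W hN _).isClosed.preimage hcont

/-- **The fibre of the support set is the product of its `S`-fibre and its away fibre** along `torusFinSplit'`. -/
theorem preimage_symm_fibreSet (b : torusFin W) :
    (torusFinSplit' W S).symm ⁻¹' fibreSet W γ₀ N γ b =
      fibreAt W S γ₀ N γ (atTf W S b) ×ˢ fibreAway W S γ₀ N γ (awayTf W S b) := by
  ext ⟨x', y'⟩
  have h := (torusFinSplit' W S).apply_symm_apply (x', y')
  rw [torusFinSplit'_apply] at h
  have hx' : atTf' W S ((torusFinSplit' W S).symm (x', y')) = x' := (Prod.ext_iff.1 h).1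
  have hy' : awayTf' W S ((torusFinSplit' W S).symm (x', y')) = y' := (Prod.ext_iff.1 h).2
  show (torusFinSplit' W S).symm (x', y') ∈ fibreSet W γ₀ N γ b ↔ _
  rw [← preimage_mk_suppSet, Set.mem_preimage, mem_suppSet_iff_parts W S, hx', hy']
  rfl

end Fibres

section Measure
variable {k : Type} [Field k] [NumberField k] (W : PlaneData k) (S : Set (HeightOneSpectrum (𝓞 k)))
  [MeasurableSpace (GA W)] [BorelSpace (GA W)] (γ₀ : GA W) (N : ℕ) (γ : GA W)

/-- **The `S`-factor of the support measure**: `(ν_S ⊗ ν′_S)(suppSetAt ∩ DZ_S × T′_S)`. -/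
def suppMeasureAt (νS : Measure (torusFinAt W S)) (νS' : Measure (torusFinAt' W S)) (DZS : Set (torusFinAt W S)) : ℝ≥0∞ :=
  (νS.prod νS') (suppSetAt W S γ₀ N γ ∩ DZS ×ˢ Set.univ)

/-- **The away factor of the support measure**: `(ν^{(S)} ⊗ ν′^{(S)})(suppSetAway ∩ DZ^{(S)} × T′^{(S)})`. -/
def suppMeasureAway (νA : Measure (torusFinAway W S)) (νA' : Measure (torusFinAway' W S))
    (DZA : Set (torusFinAway W S)) : ℝ≥0∞ :=
  (νA.prod νA') (suppSetAway W S γ₀ N γ ∩ DZA ×ˢ Set.univ)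

omit [BorelSpace (GA W)] in
/-- The away factor is `n`-free along `p^n`. -/
theorem suppMeasureAway_pow_eq (p : ℕ) (νA : Measure (torusFinAway W (placesAbove (k := k) p)))
    (νA' : Measure (torusFinAway' W (placesAbove (k := k) p))) (DZA : Set (torusFinAway W (placesAbove (k := k) p)))
    (n : ℕ) :
    suppMeasureAway W (placesAbove (k := k) p) γ₀ (p ^ n) γ νA νA' DZA =
      suppMeasureAway W (placesAbove (k := k) p) γ₀ 1 γ νA νA' DZA := by
  unfold suppMeasureAway
  rw [suppSetAway_pow_eq]

end Measure

section Product
variable {k : Type} [Field k] [NumberField k] (W : PlaneData k) (S : Set (HeightOneSpectrum (𝓞 k)))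
  [MeasurableSpace (GA W)] [BorelSpace (GA W)] (γ₀ : GA W) (N : ℕ) (γ : GA W)
  (νf : Measure (torusFin W)) (νf' : Measure (torusFin' W))
  (νS : Measure (torusFinAt W S)) (νS' : Measure (torusFinAt' W S))
  (νA : Measure (torusFinAway W S)) (νA' : Measure (torusFinAway' W S))

/-- **Each fibre of the support set has product measure**: `ν′_f(fibreSet b) = c′ · ν′_S(fibreAt b_S) · ν′^{(S)}(fibreAway
b^{(S)})` when `ν′_f = c′ • (ν′_S ⊗ ν′^{(S)})` along `torusFinSplit'`. -/
theorem measure_fibreSet_eq [νS'.IsHaarMeasure] [νA'.IsHaarMeasure] (c' : ℝ≥0)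
    (hc' : νf' = c' • Measure.map (torusFinSplit' W S).symm (νS'.prod νA')) (hN : N ≠ 0) (b : torusFin W) :
    νf' (fibreSet W γ₀ N γ b) =
      (c' : ℝ≥0∞) * (νS' (fibreAt W S γ₀ N γ (atTf W S b)) * νA' (fibreAway W S γ₀ N γ (awayTf W S b))) := by
  haveI : BorelSpace (torusT' W) := Subtype.borelSpace _
  haveI : BorelSpace (torusFin' W) := Subtype.borelSpace _
  haveI : LocallyCompactSpace (torusFinAt' W S) := locallyCompact_torusFinAt' W S
  haveI : SecondCountableTopology (torusFinAt' W S) := secondCountable_torusFinAt' W S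
  haveI : LocallyCompactSpace (torusFinAway' W S) := locallyCompact_torusFinAway' W S
  haveI : SecondCountableTopology (torusFinAway' W S) := secondCountable_torusFinAway' W S
  haveI : IsLocallyFiniteMeasure νS' := isLocallyFiniteMeasure_of_isFiniteMeasureOnCompacts
  haveI : SigmaFinite νS' := sigmaFinite_of_locallyFinite
  haveI : IsLocallyFiniteMeasure νA' := isLocallyFiniteMeasure_of_isFiniteMeasureOnCompacts
  haveI : SigmaFinite νA' := sigmaFinite_of_locallyFinite
  have hmeas : MeasurableSet (fibreSet W γ₀ N γ b) := (isClosed_fibreSet W γ₀ N γ hN b).measurableSet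
  have hsymm : Measurable (torusFinSplit' W S).symm := (torusFinSplit' W S).symm.toHomeomorph.measurable
  rw [hc', Measure.smul_apply, Measure.map_apply hsymm hmeas, preimage_symm_fibreSet, Measure.prod_prod]
  rfl

/-- The `S`-factor of the support measure as an integral over its fibres. -/
theorem suppMeasureAt_eq_lintegral [νS.IsHaarMeasure] [νS'.IsHaarMeasure] (hN : N ≠ 0) (DZS : Set (torusFinAt W S))
    (hDZS : MeasurableSet DZS) :
    suppMeasureAt W S γ₀ N γ νS νS' DZS = ∫⁻ x in DZS, νS' (fibreAt W S γ₀ N γ x) ∂νS := by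
  haveI : BorelSpace (torusT W) := Subtype.borelSpace _
  haveI : BorelSpace (torusT' W) := Subtype.borelSpace _
  haveI : BorelSpace (torusFin W) := Subtype.borelSpace _
  haveI : BorelSpace (torusFin' W) := Subtype.borelSpace _
  haveI : BorelSpace (torusFinAt W S) := Subtype.borelSpace _
  haveI : BorelSpace (torusFinAt' W S) := Subtype.borelSpace _
  haveI : LocallyCompactSpace (torusFinAt' W S) := locallyCompact_torusFinAt' W S
  haveI : SecondCountableTopology (torusFinAt' W S) := secondCountable_torusFinAt' W S
  haveI : IsLocallyFiniteMeasure νS' := isLocallyFiniteMeasure_of_isFiniteMeasureOnCompacts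
  haveI : SigmaFinite νS' := sigmaFinite_of_locallyFinite
  have hmeas : MeasurableSet (suppSetAt W S γ₀ N γ ∩ DZS ×ˢ Set.univ) :=
    (isClosed_suppSetAt W S γ₀ N γ hN).measurableSet.inter (hDZS.prod MeasurableSet.univ)
  unfold suppMeasureAt
  rw [Measure.prod_apply hmeas, ← lintegral_indicator hDZS]
  refine lintegral_congr fun x => ?_
  by_cases hx : x ∈ DZS
  · rw [Set.indicator_of_mem hx]
    congr 1
    ext x'
    simp only [Set.mem_preimage, Set.mem_inter_iff, Set.mem_prod, Set.mem_univ, and_true, hx]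
    rfl
  · rw [Set.indicator_of_notMem hx]
    have : Prod.mk x ⁻¹' (suppSetAt W S γ₀ N γ ∩ DZS ×ˢ Set.univ) = ∅ := by
      ext x'
      simp only [Set.mem_preimage, Set.mem_inter_iff, Set.mem_prod, Set.mem_univ, and_true, hx, and_false,
        Set.mem_empty_iff_false]
    rw [this, measure_empty]

/-- The away factor of the support measure as an integral over its fibres. -/
theorem suppMeasureAway_eq_lintegral [νA.IsHaarMeasure] [νA'.IsHaarMeasure] (hN : N ≠ 0)
    (DZA : Set (torusFinAway W S)) (hDZA : MeasurableSet DZA) :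
    suppMeasureAway W S γ₀ N γ νA νA' DZA = ∫⁻ y in DZA, νA' (fibreAway W S γ₀ N γ y) ∂νA := by
  haveI : BorelSpace (torusT W) := Subtype.borelSpace _
  haveI : BorelSpace (torusT' W) := Subtype.borelSpace _
  haveI : BorelSpace (torusFin W) := Subtype.borelSpace _
  haveI : BorelSpace (torusFin' W) := Subtype.borelSpace _
  haveI : BorelSpace (torusFinAway W S) := Subtype.borelSpace _
  haveI : BorelSpace (torusFinAway' W S) := Subtype.borelSpace _
  haveI : LocallyCompactSpace (torusFinAway' W S) := locallyCompact_torusFinAway' W S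
  haveI : SecondCountableTopology (torusFinAway' W S) := secondCountable_torusFinAway' W S
  haveI : IsLocallyFiniteMeasure νA' := isLocallyFiniteMeasure_of_isFiniteMeasureOnCompacts
  haveI : SigmaFinite νA' := sigmaFinite_of_locallyFinite
  have hmeas : MeasurableSet (suppSetAway W S γ₀ N γ ∩ DZA ×ˢ Set.univ) :=
    (isClosed_suppSetAway W S γ₀ N γ hN).measurableSet.inter (hDZA.prod MeasurableSet.univ)
  unfold suppMeasureAway
  rw [Measure.prod_apply hmeas, ← lintegral_indicator hDZA]
  refine lintegral_congr fun y => ?_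
  by_cases hy : y ∈ DZA
  · rw [Set.indicator_of_mem hy]
    congr 1
    ext y'
    simp only [Set.mem_preimage, Set.mem_inter_iff, Set.mem_prod, Set.mem_univ, and_true, hy]
    rfl
  · rw [Set.indicator_of_notMem hy]
    have : Prod.mk y ⁻¹' (suppSetAway W S γ₀ N γ ∩ DZA ×ˢ Set.univ) = ∅ := by
      ext y'
      simp only [Set.mem_preimage, Set.mem_inter_iff, Set.mem_prod, Set.mem_univ, and_true, hy, and_false,
        Set.mem_empty_iff_false]
    rw [this, measure_empty]

/-- **THE SUPPORT MEASURE FACTORS ALONG THE `S`-SPLIT** (S15510 (4)): for the product domain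
`DZ_f = torusFinSplit⁻¹(DZ_S ×ˢ DZ^{(S)})` and the transported product Haar measures,
`suppMeasure γ₀ DZ_f N γ = (c c′) · suppMeasureAt S … DZ_S N γ · suppMeasureAway S … DZ^{(S)} N γ`. -/
theorem suppMeasure_eq_mul [νf.IsHaarMeasure] [νf'.IsHaarMeasure] [νS.IsHaarMeasure] [νS'.IsHaarMeasure]
    [νA.IsHaarMeasure] [νA'.IsHaarMeasure] (c c' : ℝ≥0)
    (hc : νf = c • Measure.map (torusFinSplit W S).symm (νS.prod νA))
    (hc' : νf' = c' • Measure.map (torusFinSplit' W S).symm (νS'.prod νA')) (hN : N ≠ 0)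
    (DZS : Set (torusFinAt W S)) (DZA : Set (torusFinAway W S)) (hDZS : MeasurableSet DZS) (hDZA : MeasurableSet DZA) :
    suppMeasure W νf νf' γ₀ ((torusFinSplit W S) ⁻¹' (DZS ×ˢ DZA)) N γ =
      ((c : ℝ≥0∞) * c') * (suppMeasureAt W S γ₀ N γ νS νS' DZS * suppMeasureAway W S γ₀ N γ νA νA' DZA) := by
  haveI : BorelSpace (torusT W) := Subtype.borelSpace _
  haveI : BorelSpace (torusT' W) := Subtype.borelSpace _
  haveI : BorelSpace (torusFin W) := Subtype.borelSpace _
  haveI : BorelSpace (torusFin' W) := Subtype.borelSpace _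
  haveI : BorelSpace (torusFinAt W S) := Subtype.borelSpace _
  haveI : BorelSpace (torusFinAt' W S) := Subtype.borelSpace _
  haveI : BorelSpace (torusFinAway W S) := Subtype.borelSpace _
  haveI : BorelSpace (torusFinAway' W S) := Subtype.borelSpace _
  haveI : LocallyCompactSpace (torusFinAt W S) := locallyCompact_torusFinAt W S
  haveI : SecondCountableTopology (torusFinAt W S) := secondCountable_torusFinAt W S
  haveI : LocallyCompactSpace (torusFinAt' W S) := locallyCompact_torusFinAt' W S
  haveI : SecondCountableTopology (torusFinAt' W S) := secondCountable_torusFinAt' W S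
  haveI : LocallyCompactSpace (torusFinAway W S) := locallyCompact_torusFinAway W S
  haveI : SecondCountableTopology (torusFinAway W S) := secondCountable_torusFinAway W S
  haveI : LocallyCompactSpace (torusFinAway' W S) := locallyCompact_torusFinAway' W S
  haveI : SecondCountableTopology (torusFinAway' W S) := secondCountable_torusFinAway' W S
  haveI : IsLocallyFiniteMeasure νS := isLocallyFiniteMeasure_of_isFiniteMeasureOnCompacts
  haveI : SigmaFinite νS := sigmaFinite_of_locallyFinite
  haveI : IsLocallyFiniteMeasure νS' := isLocallyFiniteMeasure_of_isFiniteMeasureOnCompacts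
  haveI : SigmaFinite νS' := sigmaFinite_of_locallyFinite
  haveI : IsLocallyFiniteMeasure νA := isLocallyFiniteMeasure_of_isFiniteMeasureOnCompacts
  haveI : SigmaFinite νA := sigmaFinite_of_locallyFinite
  haveI : IsLocallyFiniteMeasure νA' := isLocallyFiniteMeasure_of_isFiniteMeasureOnCompacts
  haveI : SigmaFinite νA' := sigmaFinite_of_locallyFinite
  have he : Measurable (torusFinSplit W S) := (torusFinSplit W S).toHomeomorph.measurable
  have hsymm : Measurable (torusFinSplit W S).symm := (torusFinSplit W S).symm.toHomeomorph.measurable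
  have hP : MeasurableSet (DZS ×ˢ DZA) := hDZS.prod hDZA
  have hDZf : MeasurableSet ((torusFinSplit W S) ⁻¹' (DZS ×ˢ DZA)) := he hP
  -- the two fibre functions are measurable
  have hF : Measurable fun x : torusFinAt W S => νS' (fibreAt W S γ₀ N γ x) :=
    measurable_measure_prodMk_left (isClosed_suppSetAt W S γ₀ N γ hN).measurableSet
  have hG : Measurable fun y : torusFinAway W S => νA' (fibreAway W S γ₀ N γ y) :=
    measurable_measure_prodMk_left (isClosed_suppSetAway W S γ₀ N γ hN).measurableSet
  have hat : Measurable (atTf W S) := (continuous_atTf W S).measurable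
  have haway : Measurable (awayTf W S) := (continuous_awayTf W S).measurable
  have hint : Measurable fun b : torusFin W =>
      (c' : ℝ≥0∞) * (νS' (fibreAt W S γ₀ N γ (atTf W S b)) * νA' (fibreAway W S γ₀ N γ (awayTf W S b))) :=
    ((hF.comp hat).mul (hG.comp haway)).const_mul _
  have hPP : (torusFinSplit W S).symm ⁻¹' ((torusFinSplit W S) ⁻¹' (DZS ×ˢ DZA)) = DZS ×ˢ DZA := by
    ext q
    simp only [Set.mem_preimage, (torusFinSplit W S).apply_symm_apply]
  have hq1 : ∀ q : torusFinAt W S × torusFinAway W S, atTf W S ((torusFinSplit W S).symm q) = q.1 := by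
    intro q
    have h := (torusFinSplit W S).apply_symm_apply q
    rw [torusFinSplit_apply] at h
    exact (Prod.ext_iff.1 h).1
  have hq2 : ∀ q : torusFinAt W S × torusFinAway W S, awayTf W S ((torusFinSplit W S).symm q) = q.2 := by
    intro q
    have h := (torusFinSplit W S).apply_symm_apply q
    rw [torusFinSplit_apply] at h
    exact (Prod.ext_iff.1 h).2
  rw [suppMeasure_eq_lintegral_fibre W νf νf' γ₀ _ N γ hN hDZf]
  simp_rw [measure_fibreSet_eq W S γ₀ N γ νf' νS' νA' c' hc' hN]
  rw [hc, Measure.restrict_smul, lintegral_smul_measure, Measure.restrict_map hsymm hDZf, hPP,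
    lintegral_map hint hsymm]
  simp_rw [hq1, hq2]
  rw [← Measure.prod_restrict]
  have hFG : AEMeasurable (fun a : torusFinAt W S × torusFinAway W S =>
      νS' (fibreAt W S γ₀ N γ a.1) * νA' (fibreAway W S γ₀ N γ a.2)) ((νS.restrict DZS).prod (νA.restrict DZA)) :=
    ((hF.comp measurable_fst).mul (hG.comp measurable_snd)).aemeasurable
  rw [lintegral_const_mul'' _ hFG, lintegral_prod_mul hF.aemeasurable hG.aemeasurable,
    suppMeasureAt_eq_lintegral W S γ₀ N γ νS νS' hN DZS hDZS,
    suppMeasureAway_eq_lintegral W S γ₀ N γ νA νA' hN DZA hDZA]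
  rw [ENNReal.smul_def]
  ring

end Product

end Summit.Ventures.HodgeRepro.Tier4.Line4

end
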